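import Summits.AtomisticToContinuum.HydrodynamicLimit.Theorems.JaynesSqueezeBlockGibbsMeasurableProfiles
import HarnessLib

/-!
# Conditional Gaussian second moments under a local Gibbs law (support for `JaynesSqueeze.BlockGibbs`)

Support file (`--supports stmt-AtomisticToContinuum-13462`). In the bookkeeping of `BlockGibbs`
(`klDiv_lawAt_blockRef_eq_ofReal`) the initial-time term `E_λ⟨emp, log prof₀⟩` and the cost of a
block-constant reference at time `0` are expectations, under the local Gibbs law
`λ = localGibbsMeasure σ a₀ u₀ θ₀ N`, of ONE-BODY sums of weighted squared velocity fluctuations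
`∑ᵢ κ(xᵢ) ‖vᵢ − c(xᵢ)‖²`. Conditionally on the positions the velocities are independent Gaussians
`N(u₀(xᵢ), θ₀(xᵢ) id)` (`lintegral_localGibbsMeasure'`), so these expectations are explicit:

* `integral_norm_sub_sq_gaussMeasure` / `lintegral_norm_sub_sq_gaussMeasure` —
  `∫ ‖v − c‖² dN(u, θ id) = 3θ + ‖u − c‖²` on `ℝ³`;
* `lintegral_sum_mul_norm_sub_sq_velMeasure` — the product-Gaussian (velocity law given positions) version;
* `lintegral_sum_mul_norm_sub_sq_localGibbsMeasure` — under the local Gibbs measure (measurable bounded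
  profiles): `E_λ[∑ᵢ κ(xᵢ)‖vᵢ − c(xᵢ)‖²] = E_pos[∑ᵢ κ(xᵢ)(3θ₀(xᵢ) + ‖u₀(xᵢ) − c(xᵢ)‖²)]`, with the bound
  `≤ (N+1) B` when `κ(3θ₀ + ‖u₀ − c‖²) ≤ B` pointwise (`…_le`, Bochner form `integral_…_le`,
  integrability `integrable_…`) and the exact equipartition value `(N+1)·3/2` for `κ = (2θ₀)⁻¹`, `c = u₀`
  (`integral_sum_norm_sub_sq_div_localGibbsMeasure_eq`).

No new definitions.
-/

noncomputable section

open MeasureTheory ProbabilityTheory Filter Set Topology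
open scoped ENNReal InnerProductSpace

namespace Summit.AtomisticToContinuum.HydrodynamicLimit.Theorems.BlockGibbsLine

open Literature.MathematicalPhysics.KineticTheory Literature.Analysis.FluidPDE
open Literature.Analysis.FunctionSpaces

/-! ## One Gaussian -/

/-- `‖v − c‖²` is integrable under `gaussMeasure u θ`. [folklore] -/
theorem integrable_norm_sub_sq_gaussMeasure (u c : V3) (θ : ℝ) :
    Integrable (fun v : V3 => ‖v - c‖ ^ 2) (gaussMeasure u θ) := by
  have hsq : Integrable (fun v : V3 => ‖v‖ ^ 2) (gaussMeasure u θ) :=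
    (IsGaussian.memLp_id _ 2 (by simp)).integrable_norm_pow (by norm_num)
  have hg : Integrable (fun v : V3 => 2 * ‖v‖ ^ 2 + 2 * ‖c‖ ^ 2) (gaussMeasure u θ) :=
    (hsq.const_mul 2).add (integrable_const (2 * ‖c‖ ^ 2))
  refine hg.mono' (by fun_prop : Continuous fun v : V3 => ‖v - c‖ ^ 2).aestronglyMeasurable
    (ae_of_all _ fun v => ?_)
  rw [Real.norm_eq_abs, abs_of_nonneg (sq_nonneg _)]
  have h1 : ‖v - c‖ ≤ ‖v‖ + ‖c‖ := norm_sub_le v c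
  have h2 : ‖v - c‖ ^ 2 ≤ (‖v‖ + ‖c‖) ^ 2 := by gcongr
  nlinarith [h2, sq_nonneg (‖v‖ - ‖c‖)]

/-- **Second moment about a point of an isotropic Gaussian on `ℝ³`**:
`∫ ‖v − c‖² dN(u, θ id)(v) = 3θ + ‖u − c‖²` (`θ > 0`). [folklore] -/
theorem integral_norm_sub_sq_gaussMeasure (u c : V3) {θ : ℝ} (hθ : 0 < θ) :
    ∫ v, ‖v - c‖ ^ 2 ∂gaussMeasure u θ = 3 * θ + ‖u - c‖ ^ 2 := by
  rw [integral_gaussMeasure u hθ]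
  have hpt : ∀ w : V3, ‖u + Real.sqrt θ • w - c‖ ^ 2 =
      ‖u - c‖ ^ 2 + 2 * Real.sqrt θ * ⟪u - c, w⟫_ℝ + θ * ‖w‖ ^ 2 := by
    intro w
    rw [show u + Real.sqrt θ • w - c = (u - c) + Real.sqrt θ • w by abel, norm_add_sq_real,
      real_inner_smul_right, norm_smul, Real.norm_eq_abs, abs_of_nonneg (Real.sqrt_nonneg θ), mul_pow,
      Real.sq_sqrt hθ.le]
    ring
  simp_rw [hpt]
  have h0 : Integrable (fun _ : V3 => ‖u - c‖ ^ 2) (stdGaussian V3) := integrable_const _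
  have h1 : Integrable (fun w : V3 => 2 * Real.sqrt θ * ⟪u - c, w⟫_ℝ) (stdGaussian V3) :=
    (IsGaussian.integrable_fun_id.const_inner (u - c)).const_mul _
  have h01 : Integrable (fun w : V3 => ‖u - c‖ ^ 2 + 2 * Real.sqrt θ * ⟪u - c, w⟫_ℝ) (stdGaussian V3) :=
    h0.add h1
  have h2 : Integrable (fun w : V3 => θ * ‖w‖ ^ 2) (stdGaussian V3) :=
    integrable_norm_sq_stdGaussian.const_mul θ
  rw [integral_add h01 h2, integral_add h0 h1, integral_const,
    integral_const_mul, integral_const_mul, integral_inner IsGaussian.integrable_fun_id (u - c),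
    integral_id_stdGaussian, inner_zero_right, integral_norm_sq_stdGaussian, smul_eq_mul, probReal_univ,
    Fintype.card_fin]
  push_cast
  ring

/-- `lintegral` form of `integral_norm_sub_sq_gaussMeasure`. [folklore] -/
theorem lintegral_norm_sub_sq_gaussMeasure (u c : V3) {θ : ℝ} (hθ : 0 < θ) :
    ∫⁻ v, ENNReal.ofReal (‖v - c‖ ^ 2) ∂gaussMeasure u θ = ENNReal.ofReal (3 * θ + ‖u - c‖ ^ 2) := by
  rw [← integral_norm_sub_sq_gaussMeasure u c hθ,
    ofReal_integral_eq_lintegral_ofReal (integrable_norm_sub_sq_gaussMeasure u c θ)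
      (ae_of_all _ fun v => sq_nonneg _)]

/-! ## The velocity law given the positions -/

/-- **Weighted second moments of the velocity law given the positions** (independent Gaussians
`⊗ᵢ N(u₀(xᵢ), θ₀(xᵢ) id)`): for `κᵢ ≥ 0` and centres `cᵢ`,
`∫ ∑ᵢ κᵢ ‖vᵢ − cᵢ‖² = ∑ᵢ κᵢ (3θ₀(xᵢ) + ‖u₀(xᵢ) − cᵢ‖²)` (as a `lintegral`). [folklore] -/
theorem lintegral_sum_mul_norm_sub_sq_velMeasure {n : ℕ} (u₀ : T3 → V3) {θ₀ : T3 → ℝ}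
    (hθ0 : ∀ y, 0 < θ₀ y) (x : Fin n → T3) {κ : Fin n → ℝ} (hκ : ∀ i, 0 ≤ κ i) (c : Fin n → V3) :
    ∫⁻ v, ENNReal.ofReal (∑ i, κ i * ‖v i - c i‖ ^ 2) ∂velMeasure u₀ θ₀ x =
      ENNReal.ofReal (∑ i, κ i * (3 * θ₀ (x i) + ‖u₀ (x i) - c i‖ ^ 2)) := by
  have hpt : ∀ v : Fin n → V3, ENNReal.ofReal (∑ i, κ i * ‖v i - c i‖ ^ 2) =
      ∑ i, ENNReal.ofReal (κ i * ‖v i - c i‖ ^ 2) := fun v =>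
    ENNReal.ofReal_sum_of_nonneg fun i _ => mul_nonneg (hκ i) (sq_nonneg _)
  simp_rw [hpt]
  rw [ENNReal.ofReal_sum_of_nonneg fun i _ => mul_nonneg (hκ i)
      (add_nonneg (mul_nonneg zero_le_three (hθ0 (x i)).le) (sq_nonneg _)),
    lintegral_finsetSum _ fun i _ => ?_]
  · refine Finset.sum_congr rfl fun i _ => ?_
    have hf : Measurable fun w : V3 => ENNReal.ofReal (κ i * ‖w - c i‖ ^ 2) := by fun_prop
    have h := (measurePreserving_eval (fun j => gaussMeasure (u₀ (x j)) (θ₀ (x j))) i).lintegral_comp hf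
    simp only [Function.eval] at h
    rw [velMeasure, h]
    have hpt' : ∀ w : V3, ENNReal.ofReal (κ i * ‖w - c i‖ ^ 2) =
        ENNReal.ofReal (κ i) * ENNReal.ofReal (‖w - c i‖ ^ 2) := fun w => ENNReal.ofReal_mul (hκ i)
    simp_rw [hpt']
    rw [lintegral_const_mul _ (by fun_prop), lintegral_norm_sub_sq_gaussMeasure _ _ (hθ0 _),
      ← ENNReal.ofReal_mul (hκ i)]
  · exact (measurable_const.mul (((measurable_pi_apply i).sub measurable_const).norm.pow_const 2)).ennreal_ofReal

/-! ## Under the local Gibbs measure -/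

variable {a₀ θ₀ : T3 → ℝ} {u₀ : T3 → V3}

/-- The one-body sum `z ↦ ∑ᵢ κ(xᵢ) ‖vᵢ − c(xᵢ)‖²` is measurable. [folklore] -/
theorem measurable_sum_mul_norm_sub_sq {n : ℕ} {κ : T3 → ℝ} {c : T3 → V3} (hκm : Measurable κ)
    (hcm : Measurable c) :
    Measurable fun z : Config n (Fin 3) T3 => ∑ i, κ (z i).1 * ‖(z i).2 - c (z i).1‖ ^ 2 :=
  Finset.measurable_sum _ fun i _ => (hκm.comp (measurable_pi_apply i).fst).mul
    (((measurable_pi_apply i).snd.sub (hcm.comp (measurable_pi_apply i).fst)).norm.pow_const 2)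

/-- **Weighted squared velocity fluctuations under a local Gibbs measure** (measurable profiles,
`a₀ ≥ 0`, `θ₀ > 0`; measurable weight `κ ≥ 0` and centre field `c`):
`E_λ[∑ᵢ κ(xᵢ)‖vᵢ − c(xᵢ)‖²] = ∫ Z⁻¹ 𝟙_{no overlap} ∏ a₀(xᵢ) · ∑ᵢ κ(xᵢ)(3θ₀(xᵢ) + ‖u₀(xᵢ) − c(xᵢ)‖²) dx`
(as `lintegral`s). [folklore] -/
theorem lintegral_sum_mul_norm_sub_sq_localGibbsMeasure (ha : Measurable a₀) (hθ : Measurable θ₀)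
    (hu : Measurable u₀) (ha0 : ∀ x, 0 ≤ a₀ x) (hθ0 : ∀ x, 0 < θ₀ x) (σ : ℝ) (N : ℕ)
    {κ : T3 → ℝ} {c : T3 → V3} (hκm : Measurable κ) (hcm : Measurable c) (hκ0 : ∀ y, 0 ≤ κ y) :
    ∫⁻ z, ENNReal.ofReal (∑ i, κ (z i).1 * ‖(z i).2 - c (z i).1‖ ^ 2) ∂localGibbsMeasure σ a₀ u₀ θ₀ N =
      ∫⁻ x, ENNReal.ofReal ((canonicalPartition (Torus.geometry (Fin 3)) (hsDiameter σ N) (N + 1)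
          (localGibbsProfile a₀ u₀ θ₀))⁻¹ * posWeight a₀ (hsDiameter σ N) (N + 1) x) *
        ENNReal.ofReal (∑ i, κ (x i) * (3 * θ₀ (x i) + ‖u₀ (x i) - c (x i)‖ ^ 2)) := by
  rw [lintegral_localGibbsMeasure' ha hθ hu ha0 hθ0 σ N (measurable_sum_mul_norm_sub_sq hκm hcm).ennreal_ofReal]
  refine lintegral_congr fun x => ?_
  congr 1
  simp only [zipConfig_apply]
  exact lintegral_sum_mul_norm_sub_sq_velMeasure u₀ hθ0 x (fun i => hκ0 _) fun i => c (x i)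

/-- The marginal position density integrates to one when the local Gibbs measure is a probability
measure (measurable profiles). [folklore] -/
theorem lintegral_posWeight_eq_one' (ha : Measurable a₀) (hθ : Measurable θ₀) (hu : Measurable u₀)
    (ha0 : ∀ x, 0 ≤ a₀ x) (hθ0 : ∀ x, 0 < θ₀ x) (σ : ℝ) (N : ℕ)
    [IsProbabilityMeasure (localGibbsMeasure σ a₀ u₀ θ₀ N)] :
    ∫⁻ x, ENNReal.ofReal ((canonicalPartition (Torus.geometry (Fin 3)) (hsDiameter σ N) (N + 1)
        (localGibbsProfile a₀ u₀ θ₀))⁻¹ * posWeight a₀ (hsDiameter σ N) (N + 1) x) = 1 := by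
  have h := lintegral_localGibbsMeasure' ha hθ hu ha0 hθ0 σ N (G := fun _ => 1) measurable_const
  simp only [lintegral_const, measure_univ, mul_one] at h
  exact h.symm

/-- **Bound**: if `κ(y)(3θ₀(y) + ‖u₀(y) − c(y)‖²) ≤ B` for all `y`, then
`E_λ[∑ᵢ κ(xᵢ)‖vᵢ − c(xᵢ)‖²] ≤ (N+1) B` (as a `lintegral`). [folklore] -/
theorem lintegral_sum_mul_norm_sub_sq_localGibbsMeasure_le (ha : Measurable a₀) (hθ : Measurable θ₀)
    (hu : Measurable u₀) (ha0 : ∀ x, 0 ≤ a₀ x) (hθ0 : ∀ x, 0 < θ₀ x) (σ : ℝ) (N : ℕ)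
    [IsProbabilityMeasure (localGibbsMeasure σ a₀ u₀ θ₀ N)]
    {κ : T3 → ℝ} {c : T3 → V3} (hκm : Measurable κ) (hcm : Measurable c) (hκ0 : ∀ y, 0 ≤ κ y) {B : ℝ}
    (hB : ∀ y, κ y * (3 * θ₀ y + ‖u₀ y - c y‖ ^ 2) ≤ B) :
    ∫⁻ z, ENNReal.ofReal (∑ i, κ (z i).1 * ‖(z i).2 - c (z i).1‖ ^ 2) ∂localGibbsMeasure σ a₀ u₀ θ₀ N ≤
      ENNReal.ofReal (((N : ℝ) + 1) * B) := by
  rw [lintegral_sum_mul_norm_sub_sq_localGibbsMeasure ha hθ hu ha0 hθ0 σ N hκm hcm hκ0]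
  have hρm : Measurable fun x : Fin (N + 1) → T3 => ENNReal.ofReal
      ((canonicalPartition (Torus.geometry (Fin 3)) (hsDiameter σ N) (N + 1)
        (localGibbsProfile a₀ u₀ θ₀))⁻¹ * posWeight a₀ (hsDiameter σ N) (N + 1) x) :=
    (measurable_const.mul (measurable_posWeight' ha _ _)).ennreal_ofReal
  have hsum : ∀ x : Fin (N + 1) → T3,
      ∑ i, κ (x i) * (3 * θ₀ (x i) + ‖u₀ (x i) - c (x i)‖ ^ 2) ≤ ((N : ℝ) + 1) * B := fun x => by
    calc ∑ i, κ (x i) * (3 * θ₀ (x i) + ‖u₀ (x i) - c (x i)‖ ^ 2) ≤ ∑ _i : Fin (N + 1), B :=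
          Finset.sum_le_sum fun i _ => hB (x i)
      _ = ((N : ℝ) + 1) * B := by
          rw [Finset.sum_const, Finset.card_univ, Fintype.card_fin, nsmul_eq_mul]; push_cast; ring
  calc ∫⁻ x, ENNReal.ofReal ((canonicalPartition (Torus.geometry (Fin 3)) (hsDiameter σ N) (N + 1)
          (localGibbsProfile a₀ u₀ θ₀))⁻¹ * posWeight a₀ (hsDiameter σ N) (N + 1) x) *
          ENNReal.ofReal (∑ i, κ (x i) * (3 * θ₀ (x i) + ‖u₀ (x i) - c (x i)‖ ^ 2))
      ≤ ∫⁻ x, ENNReal.ofReal ((canonicalPartition (Torus.geometry (Fin 3)) (hsDiameter σ N) (N + 1)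
          (localGibbsProfile a₀ u₀ θ₀))⁻¹ * posWeight a₀ (hsDiameter σ N) (N + 1) x) *
          ENNReal.ofReal (((N : ℝ) + 1) * B) :=
        lintegral_mono fun x => mul_le_mul_right (ENNReal.ofReal_le_ofReal (hsum x)) _
    _ = ENNReal.ofReal (((N : ℝ) + 1) * B) := by
        rw [lintegral_mul_const _ hρm, lintegral_posWeight_eq_one' ha hθ hu ha0 hθ0 σ N, one_mul]

/-- **Equipartition**: `E_λ[∑ᵢ ‖vᵢ − u₀(xᵢ)‖²/(2θ₀(xᵢ))] = (N+1)·3/2` (as a `lintegral`). [folklore] -/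
theorem lintegral_sum_norm_sub_sq_div_localGibbsMeasure (ha : Measurable a₀) (hθ : Measurable θ₀)
    (hu : Measurable u₀) (ha0 : ∀ x, 0 ≤ a₀ x) (hθ0 : ∀ x, 0 < θ₀ x) (σ : ℝ) (N : ℕ)
    [IsProbabilityMeasure (localGibbsMeasure σ a₀ u₀ θ₀ N)] :
    ∫⁻ z, ENNReal.ofReal (∑ i, (2 * θ₀ (z i).1)⁻¹ * ‖(z i).2 - u₀ (z i).1‖ ^ 2) ∂localGibbsMeasure σ a₀ u₀ θ₀ N =
      ENNReal.ofReal (((N : ℝ) + 1) * (3 / 2)) := by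
  have hκm : Measurable fun y => (2 * θ₀ y)⁻¹ := (measurable_const.mul hθ).inv
  have hκ0 : ∀ y, 0 ≤ (2 * θ₀ y)⁻¹ := fun y => inv_nonneg.2 (mul_nonneg zero_le_two (hθ0 y).le)
  rw [lintegral_sum_mul_norm_sub_sq_localGibbsMeasure (κ := fun y => (2 * θ₀ y)⁻¹) (c := u₀) ha hθ hu ha0 hθ0 σ N hκm hu hκ0]
  have hsum : ∀ x : Fin (N + 1) → T3,
      ∑ i, (2 * θ₀ (x i))⁻¹ * (3 * θ₀ (x i) + ‖u₀ (x i) - u₀ (x i)‖ ^ 2) = ((N : ℝ) + 1) * (3 / 2) := fun x => by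
    have : ∀ i : Fin (N + 1), (2 * θ₀ (x i))⁻¹ * (3 * θ₀ (x i) + ‖u₀ (x i) - u₀ (x i)‖ ^ 2) = 3 / 2 := fun i => by
      rw [sub_self, norm_zero]
      field_simp [(hθ0 (x i)).ne']
      ring
    simp_rw [this]
    rw [Finset.sum_const, Finset.card_univ, Fintype.card_fin, nsmul_eq_mul]; push_cast; ring
  simp_rw [hsum]
  have hρm : Measurable fun x : Fin (N + 1) → T3 => ENNReal.ofReal
      ((canonicalPartition (Torus.geometry (Fin 3)) (hsDiameter σ N) (N + 1)
        (localGibbsProfile a₀ u₀ θ₀))⁻¹ * posWeight a₀ (hsDiameter σ N) (N + 1) x) :=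
    (measurable_const.mul (measurable_posWeight' ha _ _)).ennreal_ofReal
  rw [lintegral_mul_const _ hρm, lintegral_posWeight_eq_one' ha hθ hu ha0 hθ0 σ N, one_mul]

/-! ## Bochner forms -/

/-- `B` in a pointwise bound `κ(3θ₀ + ‖u₀ − c‖²) ≤ B` with `κ ≥ 0`, `θ₀ > 0` is nonnegative. [folklore] -/
theorem nonneg_of_weightBound {κ : T3 → ℝ} {c : T3 → V3} (hθ0 : ∀ x, 0 < θ₀ x) (hκ0 : ∀ y, 0 ≤ κ y) {B : ℝ}
    (hB : ∀ y, κ y * (3 * θ₀ y + ‖u₀ y - c y‖ ^ 2) ≤ B) : 0 ≤ B :=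
  (mul_nonneg (hκ0 0) (add_nonneg (mul_nonneg zero_le_three (hθ0 0).le) (sq_nonneg _))).trans (hB 0)

/-- **Integrability** of `∑ᵢ κ(xᵢ)‖vᵢ − c(xᵢ)‖²` under the local Gibbs measure, given a pointwise bound
`κ(3θ₀ + ‖u₀ − c‖²) ≤ B`. [folklore] -/
theorem integrable_sum_mul_norm_sub_sq_localGibbsMeasure (ha : Measurable a₀) (hθ : Measurable θ₀)
    (hu : Measurable u₀) (ha0 : ∀ x, 0 ≤ a₀ x) (hθ0 : ∀ x, 0 < θ₀ x) (σ : ℝ) (N : ℕ)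
    [IsProbabilityMeasure (localGibbsMeasure σ a₀ u₀ θ₀ N)]
    {κ : T3 → ℝ} {c : T3 → V3} (hκm : Measurable κ) (hcm : Measurable c) (hκ0 : ∀ y, 0 ≤ κ y) {B : ℝ}
    (hB : ∀ y, κ y * (3 * θ₀ y + ‖u₀ y - c y‖ ^ 2) ≤ B) :
    Integrable (fun z : Config (N + 1) (Fin 3) T3 => ∑ i, κ (z i).1 * ‖(z i).2 - c (z i).1‖ ^ 2)
      (localGibbsMeasure σ a₀ u₀ θ₀ N) := by
  refine ⟨(measurable_sum_mul_norm_sub_sq hκm hcm).aestronglyMeasurable, ?_⟩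
  rw [hasFiniteIntegral_iff_ofReal (ae_of_all _ fun z => Finset.sum_nonneg fun i _ =>
    mul_nonneg (hκ0 _) (sq_nonneg _))]
  exact lt_of_le_of_lt (lintegral_sum_mul_norm_sub_sq_localGibbsMeasure_le ha hθ hu ha0 hθ0 σ N hκm hcm hκ0 hB)
    ENNReal.ofReal_lt_top

/-- **Bochner bound**: `∫ ∑ᵢ κ(xᵢ)‖vᵢ − c(xᵢ)‖² dλ ≤ (N+1) B` under `κ(3θ₀ + ‖u₀ − c‖²) ≤ B`. [folklore] -/
theorem integral_sum_mul_norm_sub_sq_localGibbsMeasure_le (ha : Measurable a₀) (hθ : Measurable θ₀)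
    (hu : Measurable u₀) (ha0 : ∀ x, 0 ≤ a₀ x) (hθ0 : ∀ x, 0 < θ₀ x) (σ : ℝ) (N : ℕ)
    [IsProbabilityMeasure (localGibbsMeasure σ a₀ u₀ θ₀ N)]
    {κ : T3 → ℝ} {c : T3 → V3} (hκm : Measurable κ) (hcm : Measurable c) (hκ0 : ∀ y, 0 ≤ κ y) {B : ℝ}
    (hB : ∀ y, κ y * (3 * θ₀ y + ‖u₀ y - c y‖ ^ 2) ≤ B) :
    ∫ z, (∑ i, κ (z i).1 * ‖(z i).2 - c (z i).1‖ ^ 2) ∂localGibbsMeasure σ a₀ u₀ θ₀ N ≤ ((N : ℝ) + 1) * B := by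
  have hB0 : 0 ≤ ((N : ℝ) + 1) * B := mul_nonneg (by positivity) (nonneg_of_weightBound (u₀ := u₀) hθ0 hκ0 hB)
  rw [integral_eq_lintegral_of_nonneg_ae (ae_of_all _ fun z => Finset.sum_nonneg fun i _ =>
      mul_nonneg (hκ0 _) (sq_nonneg _)) (measurable_sum_mul_norm_sub_sq hκm hcm).aestronglyMeasurable,
    ← ENNReal.toReal_ofReal hB0]
  exact ENNReal.toReal_mono ENNReal.ofReal_ne_top
    (lintegral_sum_mul_norm_sub_sq_localGibbsMeasure_le ha hθ hu ha0 hθ0 σ N hκm hcm hκ0 hB)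

/-- **Bochner equipartition**: `∫ ∑ᵢ ‖vᵢ − u₀(xᵢ)‖²/(2θ₀(xᵢ)) dλ = (N+1)·3/2`. [folklore] -/
theorem integral_sum_norm_sub_sq_div_localGibbsMeasure_eq (ha : Measurable a₀) (hθ : Measurable θ₀)
    (hu : Measurable u₀) (ha0 : ∀ x, 0 ≤ a₀ x) (hθ0 : ∀ x, 0 < θ₀ x) (σ : ℝ) (N : ℕ)
    [IsProbabilityMeasure (localGibbsMeasure σ a₀ u₀ θ₀ N)] :
    ∫ z, (∑ i, (2 * θ₀ (z i).1)⁻¹ * ‖(z i).2 - u₀ (z i).1‖ ^ 2) ∂localGibbsMeasure σ a₀ u₀ θ₀ N =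
      ((N : ℝ) + 1) * (3 / 2) := by
  have hκm : Measurable fun y => (2 * θ₀ y)⁻¹ := (measurable_const.mul hθ).inv
  have hκ0 : ∀ y, 0 ≤ (2 * θ₀ y)⁻¹ := fun y => inv_nonneg.2 (mul_nonneg zero_le_two (hθ0 y).le)
  rw [integral_eq_lintegral_of_nonneg_ae (ae_of_all _ fun z => Finset.sum_nonneg fun i _ =>
      mul_nonneg (hκ0 _) (sq_nonneg _)) (measurable_sum_mul_norm_sub_sq hκm hu).aestronglyMeasurable,
    lintegral_sum_norm_sub_sq_div_localGibbsMeasure ha hθ hu ha0 hθ0 σ N, ENNReal.toReal_ofReal (by positivity)]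

/-- The equipartition sum is integrable under the local Gibbs measure. [folklore] -/
theorem integrable_sum_norm_sub_sq_div_localGibbsMeasure (ha : Measurable a₀) (hθ : Measurable θ₀)
    (hu : Measurable u₀) (ha0 : ∀ x, 0 ≤ a₀ x) (hθ0 : ∀ x, 0 < θ₀ x) (σ : ℝ) (N : ℕ)
    [IsProbabilityMeasure (localGibbsMeasure σ a₀ u₀ θ₀ N)] :
    Integrable (fun z : Config (N + 1) (Fin 3) T3 => ∑ i, (2 * θ₀ (z i).1)⁻¹ * ‖(z i).2 - u₀ (z i).1‖ ^ 2)
      (localGibbsMeasure σ a₀ u₀ θ₀ N) := by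
  have hκm : Measurable fun y => (2 * θ₀ y)⁻¹ := (measurable_const.mul hθ).inv
  have hκ0 : ∀ y, 0 ≤ (2 * θ₀ y)⁻¹ := fun y => inv_nonneg.2 (mul_nonneg zero_le_two (hθ0 y).le)
  refine integrable_sum_mul_norm_sub_sq_localGibbsMeasure (κ := fun y => (2 * θ₀ y)⁻¹) (c := u₀) ha hθ hu ha0 hθ0
    σ N hκm hu hκ0 (B := 3 / 2) fun y => ?_
  rw [sub_self, norm_zero]
  have h : (2 * θ₀ y)⁻¹ * (3 * θ₀ y + (0 : ℝ) ^ 2) = 3 / 2 := by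
    field_simp [(hθ0 y).ne']
    ring
  exact h.le

end Summit.AtomisticToContinuum.HydrodynamicLimit.Theorems.BlockGibbsLine

end
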